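import Summits.BirchSwinnertonDyer.BirchSwinnertonDyer.Theorems.MordellShaFreeCutKatoZetaRoadLogZero
import HarnessLib

set_option linter.dupNamespace false
set_option autoImplicit false

/-! # The zeta-vanishing currency (Z₃) of the research input of the Kato–zeta road for crux B of route
# `MordellShaFreeCut`: a ℤ-torsion class has Kummer logarithm `0` (every `W`, every `p`), so
# «the pinned Kato class is torsion at a torsion Heegner point» (Z₃) implies the annihilation half (V₃),
# hence crux B given the registered citation bundle RI7′

Cell `bsd-cn100`, prover seat `bsd-cn100-s2b-c3` (g23, 2026-08-27). THEOREMS ONLY (no definition, no named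
fact, no instance, no notation); `--supports stmt-BirchSwinnertonDyer-19160` (crux B
`AnalyticRankOneOfRankOneFiniteShaThree` of route `MordellShaFreeCut`, rung S2b). REGISTRY: untouched — the
registered line on 19160 is kato-zeta v1h (sha 5febefdcc6219422…; stubs `stub_refereedInputs` = RI7′ and
`stub_prFormulaAtThree : PRFormulaAtThreeH2`); this file asks for no act.

## What is proved

§1 (`W`- and `p`-generic plumbing, the converse companion of this seat's g6 lemma
`CongruentShaFreeCutKatoKummerLogTorsion.exists_forall_locModPk_nsmul_eq_zero_of_hasLocPKummerLog_zero`):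
if a class `x ∈ H¹(Γ_ℚ, T_pW)` is ℤ-torsion, `m • x = 0` with `m ≠ 0`, then `HasLocPKummerLog W p x 0` — the
witness is `(m, O)`: `loc_p(m • x) = loc_p(0) = 0 = κ(O)` at every level `p^k` (`locModPk`, `Point.map` and
`localKummerMap` are additive maps) and `log_ω(O) = 0 = m · 0` (`padicLogPoint_zero`).

§2 (Z₃) ⟹ (V₃), where, on exactly the binder block of (V₃) (the `hV` slot of
`MordellShaFreeCutKatoZetaRoadLogZero.cruxB_of_registeredRI7prime_of_logZero`, p528124: `W` with `j = 0`,
globally minimal; `K` imaginary quadratic, Heegner for `(N(W), 3)`, `L(W^{(d_K)},1) ≠ 0`; a TORSION Heegner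
point `P` of level `N(W)`; `L(W,1) = 0`; a Kato descent datum `D` at `3` with a v2 pin and Kato's Main
Conjecture up to powers of `3`),
* (V₃) concludes `HasLocPKummerLog W 3 pin.katoClass 0` («the `3`-adic Kummer logarithm of the pinned Kato
  class is `0`» — the annihilation half of Perrin-Riou's formula, s2b-c3 g22), and
* (Z₃) concludes `∃ m : ℕ, m ≠ 0 ∧ m • pin.katoClass = 0` («the pinned Kato class is ℤ-torsion», i.e. it
  vanishes in `H¹(ℚ, V_3W)`).
(Z₃) is the shape of the (⟹) half of Perrin-Riou's Conjecture 3.3.2 — «`L(f,s)` a un zéro d'ordre `> 1` en `1`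
si et seulement si `Tr_Λ((ω)_0) = 0`» (the bottom zeta class vanishes iff the order of vanishing exceeds one;
stated under good reduction) — and of Burungale–Skinner–Tian–Wan's Conjecture 1.12 read at `ord ≠ 1`
(«`loc_p(z_E) ≠ 0 ⟺ ord_{s=1} L = 1`», stated for every `(E, p)`), in the GLOBAL currency: no local condition,
no logarithm, no embedding `K → ℚ₃`. Under the Heegner hypothesis with `L(W^{(d_K)},1) ≠ 0` and `L(W,1) = 0`,
«`P` torsion» is «`ord_{s=1} L(W,s) ≥ 3`» by Gross–Zagier (prose only; not used formally).

§3 crux B ⟸ RI7′ ∧ (Z₃): `cruxB_of_registeredRI7prime_of_zetaVanishing` = p528124's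
`cruxB_of_registeredRI7prime_of_logZero` composed with §2 (RI7′ token-identical with the registered
`stub_refereedInputs`).

## What is NOT proved / NOT claimed

* (Z₃) is OPEN research mathematics at the additive prime `3` of a `j = 0` curve, exactly like (V₃) and
  `PRFormulaAtThreeH2` (0 printed sources at an additive prime: Perrin-Riou 1993 assumes good reduction,
  BSTW 2024 Thm. 1.13 assumes `p ∤ 2N`, Bertolini–Darmon–Venerucci 2022 Thm. A is semistable at odd `p`).
* (Z₃) is STRONGER than (V₃) (this file proves (Z₃) ⟹ (V₃) only; the converse is not claimed: a class with
  Kummer logarithm `0` need only have a multiple with vanishing LOCALISATION at `3`, g6's lemma). So as a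
  research stub (Z₃) is not weaker than the g22 candidate (V₃); its merit is the print shape (global vanishing
  of the zeta class, Perrin-Riou 3.3.2 verbatim direction). Neither implication between (Z₃) and
  `PRFormulaAtThreeH2` is claimed.
* A logarithm-free composition (Z₃) + pin transport (`CongruentShaFreeCutKatoKummerLogTorsion.exists_pow_nsmul_eq_zero_of_pin`)
  contradicting the `Λ`-module step `p^m • ι[z̄] ≠ 0` directly, without the reading (3.1″), is possible but not
  filed: (3.1″) is a tree theorem (`Kato2004.locP_kernel_isTorsion_of_rankOne_holds`), so it would not change
  the research census «crux B ⟸ RI7′ ∧ ONE research statement».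
HONEST FRAMING: nothing about BSD, the leaf `rankOne_threeConverse_mordellCurve`, Sylvester's problem, crux B,
RI7′, (V₃) or (Z₃) is proved here; a closed item would close a rung leaf of BirchSwinnertonDyer, never the
summit. PARTITION: none — RANK axis.

References: B. Perrin-Riou, Ann. Inst. Fourier 43 (1993) §3.3, Conj. 3.3.2 (p. 976) [PerrinRiou1993AIF];
A. Burungale, C. Skinner, Y. Tian, X. Wan, arXiv:2409.01350, Conj. 1.12 and Thm. 1.13 [BurungaleSkinnerTianWan2024];
M. Bertolini, H. Darmon, R. Venerucci (2022) Thm. A [BertoliniDarmonVenerucci2022]; K. Kato, Astérisque 295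
(2004) §14.14 (14.14.1) (p. 243) [Kato2004Asterisque]; S. Bloch, K. Kato (1990) Ex. 3.11 [BlochKato1990];
A. Burungale, C. Skinner, App. A to arXiv:2210.10730, §10.1.2–§10.1.3 (pp. 33–34) [AlpogeBhargavaShnidman2022];
J. Silverman, AEC (2009) IV.6.4, VIII.§2 [SilvermanAEC2009]; tree: `Kato2004/LocPKummerLog.lean`
(`HasLocPKummerLog`, `locModPk`, `padicLogLocal`), `Theorems/CongruentShaFreeCutKatoDescentDatumOfH2.lean`
(`KatoDescentDatumPinH2.katoClass`), `Theorems/MordellShaFreeCutKatoZetaRoadLogZero.lean` (p528124),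
`Theorems/CongruentShaFreeCutKatoKummerLogTorsion.lean` (g6).
-/

noncomputable section

open scoped Classical

open WeierstrassCurve NumberField IsDedekindDomain Field Literature.NumberTheory.EllipticCurves
  Literature.NumberTheory.EllipticCurves.Kato2004 Literature.NumberTheory.EllipticCurves.IwasawaAlgebra
  Literature.NumberTheory.EllipticCurves.Kato2004.EulerSystemValues
  Literature.NumberTheory.GaloisRepresentations
  Summit.BirchSwinnertonDyer.Rank1Residual.Additive
  Summit.BirchSwinnertonDyer.BirchSwinnertonDyer.Theses.MordellShaFreeCut
  Summit.BirchSwinnertonDyer.BirchSwinnertonDyer.Theorems.CongruentShaFreeCutKatoDescentDatumOfH2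
open Summit.BirchSwinnertonDyer.BirchSwinnertonDyer.Theorems.MordellShaFreeCutKatoZetaRoadLogZero
  (cruxB_of_registeredRI7prime_of_logZero)

namespace Summit.BirchSwinnertonDyer.BirchSwinnertonDyer.Theorems.MordellShaFreeCutKatoZetaRoadZetaVanishing

/-! ## §1 A ℤ-torsion class has Kummer logarithm `0` (every `W`, every `p`) -/

section Torsion

variable (W : WeierstrassCurve ℚ) [W.IsElliptic] [W.IsGloballyMinimal] (p : ℕ) [Fact p.Prime]
  [ContinuousSMul ℤ_[p] (W.tateModule p)]

/-- **A ℤ-torsion class has Kummer logarithm `0`.** If `x ∈ H¹(Γ_ℚ, T_pW)` satisfies `m • x = 0` with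
`m ≠ 0`, then `HasLocPKummerLog W p x 0`: the witness pair is `(m, O)` — `loc_p(m • x) = loc_p(0) = 0` is the
local Kummer class of `O ∈ E(ℚ_p)` at every level `p^k` (all maps additive), and `log_ω(O) = 0 = m · 0`
(`padicLogPoint_zero`). The converse companion of this seat's g6 lemma
`CongruentShaFreeCutKatoKummerLogTorsion.exists_forall_locModPk_nsmul_eq_zero_of_hasLocPKummerLog_zero`
(whose conclusion is only the vanishing of a multiple of `loc_p x`). [cite: BlochKato1990, Ex. 3.11]
[cite: AlpogeBhargavaShnidman2022, App. A §10.1.2 (p. 33)] [cite: SilvermanAEC2009, IV.6.4 and VIII.§2] -/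
theorem hasLocPKummerLog_zero_of_nsmul_eq_zero (x : H1 (tateRep W p) ⊤) {m : ℕ} (hm : m ≠ 0)
    (hx : m • x = 0) : HasLocPKummerLog W p x 0 := by
  refine ⟨m, 0, hm, fun k ↦ ?_, ?_⟩
  · simp only [hx, map_zero]
  · rw [mul_zero, padicLogLocal, nsmul_zero, WeierstrassCurve.padicLogPoint_zero, zero_div]

end Torsion

/-! ## §2 (Z₃) ⟹ (V₃): zeta-vanishing implies the annihilation half, on the binder block of p528124 -/

/-- **(Z₃) ⟹ (V₃).** On exactly the binder block of the `hV` slot of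
`MordellShaFreeCutKatoZetaRoadLogZero.cruxB_of_registeredRI7prime_of_logZero` (p528124) — `j(W) = 0`, `W`
globally minimal, `K` Heegner for `(N(W), 3)` with `L(W^{(d_K)},1) ≠ 0`, a TORSION Heegner point `P`,
`L(W,1) = 0`, a v2-pinned Kato descent datum at `3` with Kato's Main Conjecture up to powers of `3` — the
GLOBAL statement (Z₃) «the pinned Kato class is ℤ-torsion» implies the LOCAL statement (V₃) «its `3`-adic
Kummer logarithm is `0`», by §1. (Z₃) has the shape of the (⟹) half of Perrin-Riou's Conj. 3.3.2 (the bottom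
zeta class vanishes when `ord_{s=1} L > 1`; good reduction there) and of BSTW Conj. 1.12 read at `ord ≠ 1`
(any `(E,p)` there); it is OPEN at the additive prime `3`. The converse (V₃) ⟹ (Z₃) is not claimed.
[cite: PerrinRiou1993AIF, §3.3, Conj. 3.3.2 (p. 976)] [cite: BurungaleSkinnerTianWan2024, Conj. 1.12]
[cite: Kato2004Asterisque, §14.14 (14.14.1) (p. 243)] -/
theorem logZeroAtThree_of_zetaVanishing
    (hZ : ∀ (W : WeierstrassCurve ℚ) [W.IsElliptic] [W.IsGloballyMinimal]
      [ContinuousSMul ℤ_[3] (W.tateModule 3)], W.j = 0 →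
      ∀ (K : Type) [Field K] [NumberField K] (N : ℕ) [NeZero N],
        W.conductorNorm ℤ = N → IsImaginaryQuadratic K →
          SatisfiesHeegnerHypothesis N K → SatisfiesHeegnerHypothesis 3 K →
            (W.quadraticTwist (NumberField.discr K : ℚ)).entireLFunction 1 ≠ 0 →
        ∀ (P : (W.baseChange K).toAffine.Point), IsHeegnerPoint N W K P → IsOfFinAddOrder P →
          W.entireLFunction 1 = 0 →
        ∀ (D : KatoDescentDatum 3) (pin : KatoDescentDatumPinH2 W 3 D),
          (∃ a b : ℕ,
            Ideal.span {((3 : ℕ) : IwasawaAlgebra 3) ^ a} * Module.charIdeal (IwasawaAlgebra 3) D.H2 =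
              Ideal.span {((3 : ℕ) : IwasawaAlgebra 3) ^ b} *
                Module.charIdeal (IwasawaAlgebra 3) (D.H ⧸ (IwasawaAlgebra 3) ∙ D.z)) →
          ∃ m : ℕ, m ≠ 0 ∧ m • pin.katoClass = 0) :
    ∀ (W : WeierstrassCurve ℚ) [W.IsElliptic] [W.IsGloballyMinimal]
      [ContinuousSMul ℤ_[3] (W.tateModule 3)], W.j = 0 →
      ∀ (K : Type) [Field K] [NumberField K] (N : ℕ) [NeZero N],
        W.conductorNorm ℤ = N → IsImaginaryQuadratic K →
          SatisfiesHeegnerHypothesis N K → SatisfiesHeegnerHypothesis 3 K →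
            (W.quadraticTwist (NumberField.discr K : ℚ)).entireLFunction 1 ≠ 0 →
        ∀ (P : (W.baseChange K).toAffine.Point), IsHeegnerPoint N W K P → IsOfFinAddOrder P →
          W.entireLFunction 1 = 0 →
        ∀ (D : KatoDescentDatum 3) (pin : KatoDescentDatumPinH2 W 3 D),
          (∃ a b : ℕ,
            Ideal.span {((3 : ℕ) : IwasawaAlgebra 3) ^ a} * Module.charIdeal (IwasawaAlgebra 3) D.H2 =
              Ideal.span {((3 : ℕ) : IwasawaAlgebra 3) ^ b} *
                Module.charIdeal (IwasawaAlgebra 3) (D.H ⧸ (IwasawaAlgebra 3) ∙ D.z)) →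
          HasLocPKummerLog W 3 pin.katoClass 0 := by
  intro W _ _ _ hj K _ _ N _ hN hK hHN hH3 hLK P hP hPtor hL D pin hMC
  obtain ⟨m, hm, hx⟩ := hZ W hj K N hN hK hHN hH3 hLK P hP hPtor hL D pin hMC
  exact hasLocPKummerLog_zero_of_nsmul_eq_zero W 3 pin.katoClass hm hx

/-! ## §3 Crux B from the registered citation bundle RI7′ and (Z₃) -/

/-- **Crux B ⟸ RI7′ ∧ (Z₃).** The REGISTERED citation-borne stub of the v1h line (RI7′ — 3-parity,
modularity, Hoffstein–Luo, Kato finiteness, Heegner points, Gross–Zagier + Kolyvagin, and Kato (12.2.2)'s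
`Kato2004.one_le_rank_iwasawaH1` — token for token the type of `stub_refereedInputs`) together with the
zeta-vanishing statement (Z₃) gives crux B `AnalyticRankOneOfRankOneFiniteShaThree` BY NAME: p528124's
`cruxB_of_registeredRI7prime_of_logZero` composed with §2. Census reading: crux B ⟸ seven citation-borne facts
+ ONE research statement, in a third currency (Z₃) beside `PRFormulaAtThreeH2` (registered) and (V₃) (g22);
(Z₃) ⟹ (V₃) ⟸ `PRFormulaAtThreeH2`. CONDITIONAL; closes nothing; no registry act implied.
[cite: Kato2004Asterisque, §12.2 (12.2.2) (p. 220), Cor. 14.3] [cite: DokchitserDokchitserAnnals2010, Thm. 1.4]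
[cite: GrossZagier1986, Thm. I.6.3 with V.§2] [cite: Gross1984, §§3–4] [cite: PerrinRiou1993AIF, §3.3, Conj. 3.3.2 (p. 976)] -/
theorem cruxB_of_registeredRI7prime_of_zetaVanishing
    (RI : (∀ (W : WeierstrassCurve ℚ) [W.IsElliptic] (p : ℕ) [Fact p.Prime], p_parity W p) ∧
      ModularForms.exists_isNewformOf ∧
      HoffsteinLuo1997_exists_twist_L_one_ne_zero ∧
      (∀ (W : WeierstrassCurve ℚ) [W.IsElliptic] (p : ℕ) [Fact p.Prime],
        kato_finite_of_L_one_ne_zero W p) ∧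
      (∀ (W : WeierstrassCurve ℚ) (K : Type) [Field K] [NumberField K], exists_isHeegnerPoint W K) ∧
      (∀ (W : WeierstrassCurve ℚ) (N : ℕ) [NeZero N] (K : Type) [Field K] [NumberField K],
        analyticRankEK_eq_one_iff_heegner_nonTorsion W N K) ∧
      one_le_rank_iwasawaH1)
    (hZ : ∀ (W : WeierstrassCurve ℚ) [W.IsElliptic] [W.IsGloballyMinimal]
      [ContinuousSMul ℤ_[3] (W.tateModule 3)], W.j = 0 →
      ∀ (K : Type) [Field K] [NumberField K] (N : ℕ) [NeZero N],
        W.conductorNorm ℤ = N → IsImaginaryQuadratic K →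
          SatisfiesHeegnerHypothesis N K → SatisfiesHeegnerHypothesis 3 K →
            (W.quadraticTwist (NumberField.discr K : ℚ)).entireLFunction 1 ≠ 0 →
        ∀ (P : (W.baseChange K).toAffine.Point), IsHeegnerPoint N W K P → IsOfFinAddOrder P →
          W.entireLFunction 1 = 0 →
        ∀ (D : KatoDescentDatum 3) (pin : KatoDescentDatumPinH2 W 3 D),
          (∃ a b : ℕ,
            Ideal.span {((3 : ℕ) : IwasawaAlgebra 3) ^ a} * Module.charIdeal (IwasawaAlgebra 3) D.H2 =
              Ideal.span {((3 : ℕ) : IwasawaAlgebra 3) ^ b} *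
                Module.charIdeal (IwasawaAlgebra 3) (D.H ⧸ (IwasawaAlgebra 3) ∙ D.z)) →
          ∃ m : ℕ, m ≠ 0 ∧ m • pin.katoClass = 0) :
    AnalyticRankOneOfRankOneFiniteShaThree :=
  cruxB_of_registeredRI7prime_of_logZero RI (logZeroAtThree_of_zetaVanishing hZ)

end Summit.BirchSwinnertonDyer.BirchSwinnertonDyer.Theorems.MordellShaFreeCutKatoZetaRoadZetaVanishing

end
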